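import Literature.Analysis.FluidPDE.PeriodicCylinderExtensionTerms
import Mathlib.Algebra.Order.Chebyshev
import HarnessLib

/-!
# The radial Seeley extension is bounded on every Sobolev space `H^k` simultaneously

Analysis/FluidPDE support file, sequel of `PeriodicCylinderExtension.lean` and
`PeriodicCylinderExtensionTerms.lean` (the radial Seeley extension `cylExtend` across the wall of
the periodic cylinder, for `Literature.Analysis.FluidPDE.KatoLai1984_periodicCylinderUniformExistence`;
Kato–Lai 1984, §7, (7.1): an extension operator "bounded on `H^s(Ω)` to `H^s(ℝ^m)` for
`0 ≤ s ≤ s₁`"). We prove the **`L²` bounds of all derivatives of the extension on a period slab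
by the derivatives of the function on the period cell**, with one constant per order and for the
single operator `cylExtend`:

* `exists_lintegral_iteratedFDeriv_cylExtend_le` — for every `n` there is `C < ∞` such that for
  every `L`, every `f` that is `C^∞` on the closed cylinder and every `j ≤ n`,
  `∫⁻_{0 < z < L} ‖Dʲ (cylExtend f)‖² ≤ C ∑_{l ≤ n} ∫⁻_{cell L} ‖Dˡ f‖²`.

Proof (Seeley 1964, proof of the Theorem, in `L²` form): on the outer collar the raw extension is
the series `∑_k T_k f`; on `{r > 1 + η}` it is a finite sum, whose `L²` norm is bounded by
Minkowski's inequality and the per-term bounds of `PeriodicCylinderExtensionTerms`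
(`‖Dʲ T_k f‖ ≲ |a_k| 4^{kn} ∑_l ‖Dˡ f ∘ R_k‖` pointwise, and the change of variables under `R_k`),
summed with Seeley's `∑_k |a_k| 4^{kn} < ∞` (`Seeley.summable_abs_coeff_mul_pow`) uniformly in
`η`; monotone convergence `η → 0`; the cutoff by the Leibniz rule; inside the cylinder
`cylExtend f = f`; the wall `{r = 1}` and the level set `{r = 5/4}` are null
(`volume_setOf_cylRadius_eq`, cylindrical coordinates and `Measure.pi_hyperplane`).

Everything is proved; no named fact and no `sorry` is introduced.

## Mathlib / tree search

Mathlib: `norm_iteratedFDeriv_smul_le`, `iteratedFDerivWithin_sum_apply`, `eLpNorm_sum_le`,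
`eLpNorm_eq_lintegral_rpow_enorm_toReal`, `lintegral_iSup`, `lintegral_union_le`,
`Finset.sq_sum_le_card_mul_sum_sq`, `Measure.pi_hyperplane`, `Summable.sum_le_tsum`.
Tree: `seeleyTerm`, `norm_iteratedFDeriv_seeleyTerm_le`, `iteratedFDeriv_seeleyTerm_eq_zero`,
`setLIntegral_comp_radialReflect_le`, `rawExtend_eq_sum`, `contDiff_rawExtend`, `cylExtend_eq_zero`,
`cylExtend_of_le_one`, `lintegral_eq_lintegral_cylCoord`.

## References

* R. T. Seeley, *Extension of `C^∞` functions defined in a half space*, Proc. Amer. Math. Soc. 15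
  (1964) 625–626, Theorem and Lemma. [Seeley1964]
* T. Kato, C. Y. Lai, J. Funct. Anal. 56 (1984) 15–28, §7, (7.1). [KatoLai1984]
-/

noncomputable section

open MeasureTheory Set Function Filter Topology TopologicalSpace WithLp Finset
open scoped ContDiff NNReal ENNReal InnerProductSpace RealInnerProductSpace Nat

namespace Literature.Analysis.FluidPDE

open Literature.Analysis.Calculus

/-- Local notation for physical space `ℝ³ = EuclideanSpace ℝ (Fin 3)`. -/
local notation "ℝ³" => EuclideanSpace ℝ (Fin 3)

/-- Local notation for the closed unit cylinder `{r ≤ 1}`. -/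
local notation "𝕂" => closure (SetLike.coe unitCylinder : Set (EuclideanSpace ℝ (Fin 3)))

namespace PeriodicCylinder

variable {F : Type*} [NormedAddCommGroup F] [NormedSpace ℝ F]

/-! ### Null level sets of the radius -/

/-- **Level sets of the cylindrical radius are null**: `vol {r = c} = 0` (in cylindrical
coordinates the set is the hyperplane `{p₀ = c}` of the parameter space). [folklore] -/
theorem volume_setOf_cylRadius_eq (c : ℝ) : volume {x : ℝ³ | cylRadius x = c} = 0 := by
  set S : Set ℝ³ := {x | cylRadius x = c} with hS
  have hSm : MeasurableSet S := (isClosed_eq continuous_cylRadius continuous_const).measurableSet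
  have hplane : volume {p : Fin 3 → ℝ | p 0 = c} = 0 := by
    rw [volume_pi]
    exact Measure.pi_hyperplane (fun _ : Fin 3 => (volume : Measure ℝ)) (0 : Fin 3) c
  rw [← lintegral_indicator_one hSm, lintegral_eq_lintegral_cylCoord]
  refine le_antisymm ?_ bot_le
  calc ∫⁻ p in {p : Fin 3 → ℝ | 0 < p 0 ∧ p 1 ∈ Set.Ioo (-Real.pi) Real.pi},
        ENNReal.ofReal (p 0) * S.indicator 1 (cylCoord p)
      ≤ ∫⁻ p in {p : Fin 3 → ℝ | 0 < p 0 ∧ p 1 ∈ Set.Ioo (-Real.pi) Real.pi},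
          ({p : Fin 3 → ℝ | p 0 = c}).indicator (fun p => ENNReal.ofReal (p 0)) p := by
        refine setLIntegral_mono' ?_ fun p hp => ?_
        · exact ((isOpen_lt continuous_const (continuous_apply 0)).inter
            (isOpen_Ioo.preimage (continuous_apply 1))).measurableSet
        · by_cases h : cylCoord p ∈ S
          · have : p 0 = c := by
              have h' : cylRadius (cylCoord p) = c := h
              rwa [cylRadius_cylCoord hp.1.le] at h'
            rw [indicator_of_mem h, indicator_of_mem (show p ∈ {p : Fin 3 → ℝ | p 0 = c} from this)]
            simp
          · rw [indicator_of_notMem h, mul_zero]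
            exact bot_le
    _ ≤ ∫⁻ p, ({p : Fin 3 → ℝ | p 0 = c}).indicator (fun p => ENNReal.ofReal (p 0)) p :=
        setLIntegral_le_lintegral _ _
    _ = ∫⁻ p in {p : Fin 3 → ℝ | p 0 = c}, ENNReal.ofReal (p 0) :=
        lintegral_indicator (isClosed_eq (continuous_apply 0) continuous_const).measurableSet _
    _ = 0 := setLIntegral_measure_zero _ _ hplane

/-- Integrals over level sets of the radius vanish. [folklore] -/
theorem setLIntegral_cylRadius_eq (c : ℝ) (G : ℝ³ → ℝ≥0∞) : ∫⁻ x in {x : ℝ³ | cylRadius x = c}, G x = 0 :=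
  setLIntegral_measure_zero _ _ (volume_setOf_cylRadius_eq c)

/-! ### `L²` bookkeeping -/

/-- `‖·‖_{L²}² = ∫⁻ ‖·‖ₑ²`: if `∫⁻ ‖g‖ₑ² ≤ M²` then `‖g‖_{L²} ≤ M`. [folklore] -/
theorem eLpNorm_two_le_of_lintegral_le {α : Type*} {_ : MeasurableSpace α} {μ : Measure α}
    {G : Type*} [NormedAddCommGroup G] {g : α → G} {M : ℝ≥0∞}
    (h : ∫⁻ x, ‖g x‖ₑ ^ 2 ∂μ ≤ M ^ 2) : eLpNorm g 2 μ ≤ M := by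
  rw [eLpNorm_eq_lintegral_rpow_enorm_toReal (by norm_num) (by norm_num)]
  simp only [ENNReal.toReal_ofNat, ENNReal.rpow_ofNat, one_div]
  calc (∫⁻ x, ‖g x‖ₑ ^ 2 ∂μ) ^ (2 : ℝ)⁻¹ ≤ (M ^ 2) ^ (2 : ℝ)⁻¹ := ENNReal.rpow_le_rpow h (by norm_num)
    _ = M := by
        rw [show M ^ 2 = M ^ (2 : ℝ) from (ENNReal.rpow_ofNat M 2).symm, ← ENNReal.rpow_mul]
        norm_num

/-- Conversely, if `‖g‖_{L²} ≤ M` then `∫⁻ ‖g‖ₑ² ≤ M²`. [folklore] -/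
theorem lintegral_le_of_eLpNorm_two_le {α : Type*} {_ : MeasurableSpace α} {μ : Measure α}
    {G : Type*} [NormedAddCommGroup G] {g : α → G} {M : ℝ≥0∞}
    (h : eLpNorm g 2 μ ≤ M) : ∫⁻ x, ‖g x‖ₑ ^ 2 ∂μ ≤ M ^ 2 := by
  rw [eLpNorm_eq_lintegral_rpow_enorm_toReal (by norm_num) (by norm_num)] at h
  simp only [ENNReal.toReal_ofNat, ENNReal.rpow_ofNat, one_div] at h
  have h2 := ENNReal.rpow_le_rpow h (show (0 : ℝ) ≤ 2 by norm_num)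
  rw [← ENNReal.rpow_mul, show (2 : ℝ)⁻¹ * 2 = 1 by norm_num, ENNReal.rpow_one] at h2
  calc ∫⁻ x, ‖g x‖ₑ ^ 2 ∂μ ≤ M ^ (2 : ℝ) := h2
    _ = M ^ 2 := ENNReal.rpow_ofNat M 2

/-- `ofReal (‖v‖²) = ‖v‖ₑ²`. [folklore] -/
theorem ofReal_norm_sq {G : Type*} [NormedAddCommGroup G] (v : G) : ENNReal.ofReal (‖v‖ ^ 2) = ‖v‖ₑ ^ 2 := by
  rw [ENNReal.ofReal_pow (norm_nonneg _), ofReal_norm]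

/-! ### The regions -/

/-- The outer collar of a period slab: `{1 < r < 5/4, 0 < z < L}`. [folklore] -/
def outer (L : ℝ) : Set ℝ³ := {x | 1 < cylRadius x ∧ cylRadius x < 5 / 4 ∧ x 2 ∈ Set.Ioo 0 L}

/-- The outer collar is open. [folklore] -/
theorem isOpen_outer (L : ℝ) : IsOpen (outer L) :=
  (isOpen_lt continuous_const continuous_cylRadius).inter
    ((isOpen_lt continuous_cylRadius continuous_const).inter
      (isOpen_Ioo.preimage (EuclideanSpace.proj (2 : Fin 3)).continuous))

/-- The open exterior `Ω₁ = {r > 1}` of the closed cylinder. [folklore] -/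
def exterior : Set ℝ³ := {x | 1 < cylRadius x}

/-- `Ω₁` is open. [folklore] -/
theorem isOpen_exterior : IsOpen exterior := isOpen_lt continuous_const continuous_cylRadius

/-- Every term `T_k f` is smooth on `Ω₁`. [folklore] -/
theorem contDiffOn_seeleyTerm_exterior (k : ℕ) {f : ℝ³ → F} (hf : ContDiffOn ℝ ∞ f 𝕂) :
    ContDiffOn ℝ ∞ (seeleyTerm k f) exterior := fun _ hx =>
  (contDiffAt_weight_smul_reflect hf k hx).contDiffWithinAt

/-- The cell energy `𝓔_n(f) = ∑_{l ≤ n} ∫⁻_{cell} ‖Dˡ f‖ₑ²`. [folklore] -/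
def cellEnergy (L : ℝ) (n : ℕ) (f : ℝ³ → F) : ℝ≥0∞ :=
  ∑ l ∈ range (n + 1), ∫⁻ x in (cylinderCell L : Set ℝ³), ‖iteratedFDeriv ℝ l f x‖ₑ ^ 2

/-! ### Per-term `L²` bounds -/

/-- **`L²` bound for the `k`-th term on the outer collar**: with the constant `K` of
`norm_iteratedFDeriv_seeleyTerm_le`,
`∫⁻_{outer} ‖Dʲ (T_k f)‖ₑ² ≤ 2 (n+1) (K |a_k| 4^{kn})² 𝓔_n(f)` for `j ≤ n`. [cite: Seeley1964, Theorem] -/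
theorem lintegral_seeleyTerm_sq_le (n : ℕ) : ∃ K : ℝ, 0 ≤ K ∧ ∀ (L : ℝ) (k : ℕ) (f : ℝ³ → F),
    ContDiffOn ℝ ∞ f 𝕂 → ∀ j ≤ n,
      ∫⁻ x in outer L, ‖iteratedFDeriv ℝ j (seeleyTerm k f) x‖ₑ ^ 2 ≤
        ENNReal.ofReal ((K * |Seeley.coeff k| * ((2 : ℝ) ^ k) ^ (2 * n)) ^ 2 * (2 * (n + 1))) * cellEnergy L n f := by
  obtain ⟨K, hK0, hK⟩ := norm_iteratedFDeriv_seeleyTerm_le (F := F) n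
  refine ⟨K, hK0, fun L k f hf j hjn => ?_⟩
  set A : ℝ := K * |Seeley.coeff k| * ((2 : ℝ) ^ k) ^ (2 * n) with hA
  have hA0 : 0 ≤ A := by positivity
  set W : Set ℝ³ := {x | (2 : ℝ) ^ k * (cylRadius x - 1) ≤ 1 / 4} with hW
  have hWm : MeasurableSet W :=
    (isClosed_le (continuous_const.mul (continuous_cylRadius.sub continuous_const)) continuous_const).measurableSet
  set Sfun : ℝ³ → ℝ≥0∞ := fun x => ∑ l ∈ range (n + 1), ‖iteratedFDeriv ℝ l f (radialReflect k x)‖ₑ ^ 2 with hSfun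
  -- pointwise bound on the outer collar
  have hpt : ∀ x ∈ outer L, ‖iteratedFDeriv ℝ j (seeleyTerm k f) x‖ₑ ^ 2 ≤
      W.indicator (fun x => ENNReal.ofReal (A ^ 2 * (n + 1)) * Sfun x) x := by
    intro x hx
    by_cases hxW : x ∈ W
    · have hxW' : (2 : ℝ) ^ k * (cylRadius x - 1) ≤ 1 / 4 := hxW
      have hxK : x ∈ collarK k := ⟨⟨hx.1, by linarith [hx.2.1]⟩, by linarith⟩
      have hb := hK k f hf x hxK j hjn
      rw [indicator_of_mem hxW, ← ofReal_norm_sq]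
      have hsq : ‖iteratedFDeriv ℝ j (seeleyTerm k f) x‖ ^ 2 ≤
          A ^ 2 * (n + 1) * ∑ l ∈ range (n + 1), ‖iteratedFDeriv ℝ l f (radialReflect k x)‖ ^ 2 := by
        have h1 : ‖iteratedFDeriv ℝ j (seeleyTerm k f) x‖ ^ 2 ≤
            (A * ∑ l ∈ range (n + 1), ‖iteratedFDeriv ℝ l f (radialReflect k x)‖) ^ 2 :=
          pow_le_pow_left₀ (norm_nonneg _) hb 2
        have h2 := sq_sum_le_card_mul_sum_sq (s := range (n + 1))
          (f := fun l => ‖iteratedFDeriv ℝ l f (radialReflect k x)‖)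
        rw [card_range] at h2
        calc _ ≤ _ := h1
          _ = A ^ 2 * (∑ l ∈ range (n + 1), ‖iteratedFDeriv ℝ l f (radialReflect k x)‖) ^ 2 := by ring
          _ ≤ A ^ 2 * ((n + 1 : ℕ) * ∑ l ∈ range (n + 1), ‖iteratedFDeriv ℝ l f (radialReflect k x)‖ ^ 2) :=
              mul_le_mul_of_nonneg_left h2 (sq_nonneg _)
          _ = _ := by push_cast; ring
      refine (ENNReal.ofReal_le_ofReal hsq).trans (le_of_eq ?_)
      rw [ENNReal.ofReal_mul (by positivity), ENNReal.ofReal_sum_of_nonneg fun l _ => sq_nonneg _]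
      simp only [hSfun, ofReal_norm_sq]
    · have hxW' : 1 / 4 < (2 : ℝ) ^ k * (cylRadius x - 1) := not_le.1 hxW
      rw [iteratedFDeriv_seeleyTerm_eq_zero k f hxW' j, indicator_of_notMem hxW]
      simp
  -- integrate: the support lies in the thin collar up to a null level set
  have hOm : MeasurableSet (outer L) := (isOpen_outer L).measurableSet
  have hsub : outer L ∩ W ⊆ thinCollar L k ∪ {x | cylRadius x = 1 + ((2 : ℝ) ^ k)⁻¹ / 4} := by
    rintro x ⟨hxO, hxW⟩
    have hxW' : (2 : ℝ) ^ k * (cylRadius x - 1) ≤ 1 / 4 := hxW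
    rcases hxW'.lt_or_eq with h | h
    · exact Or.inl ⟨hxO.1, h, hxO.2.2⟩
    · right
      have h2k : (0 : ℝ) < (2 : ℝ) ^ k := by positivity
      show cylRadius x = 1 + ((2 : ℝ) ^ k)⁻¹ / 4
      field_simp
      linarith
  calc ∫⁻ x in outer L, ‖iteratedFDeriv ℝ j (seeleyTerm k f) x‖ₑ ^ 2
      ≤ ∫⁻ x in outer L, W.indicator (fun x => ENNReal.ofReal (A ^ 2 * (n + 1)) * Sfun x) x :=
        setLIntegral_mono' hOm hpt
    _ = ∫⁻ x in outer L ∩ W, ENNReal.ofReal (A ^ 2 * (n + 1)) * Sfun x := by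
        rw [lintegral_indicator hWm, Measure.restrict_restrict hWm, Set.inter_comm]
    _ ≤ ∫⁻ x in thinCollar L k ∪ {x | cylRadius x = 1 + ((2 : ℝ) ^ k)⁻¹ / 4},
          ENNReal.ofReal (A ^ 2 * (n + 1)) * Sfun x := lintegral_mono_set hsub
    _ ≤ (∫⁻ x in thinCollar L k, ENNReal.ofReal (A ^ 2 * (n + 1)) * Sfun x) +
          ∫⁻ x in {x | cylRadius x = 1 + ((2 : ℝ) ^ k)⁻¹ / 4}, ENNReal.ofReal (A ^ 2 * (n + 1)) * Sfun x :=
        lintegral_union_le _ _ _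
    _ = ENNReal.ofReal (A ^ 2 * (n + 1)) * ∫⁻ x in thinCollar L k, Sfun x := by
        rw [setLIntegral_cylRadius_eq, add_zero, lintegral_const_mul' _ _ ENNReal.ofReal_ne_top]
    _ ≤ ENNReal.ofReal (A ^ 2 * (n + 1)) * (2 * cellEnergy L n f) := by
        refine mul_le_mul' le_rfl ?_
        -- sum over `l`, each term by the change of variables
        have hmeas : ∀ l ∈ range (n + 1), AEMeasurable
            (fun x => ‖iteratedFDeriv ℝ l f (radialReflect k x)‖ₑ ^ 2) (volume.restrict (thinCollar L k)) := by
          intro l _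
          have hfo : ContDiffOn ℝ ∞ f (unitCylinder : Set ℝ³) := hf.mono subset_closure
          have hcont : ContinuousOn (fun x => iteratedFDeriv ℝ l f (radialReflect k x)) (thinCollar L k) := by
            have h1 : ContinuousOn (iteratedFDeriv ℝ l f) (unitCylinder : Set ℝ³) := by
              have := hfo.continuousOn_iteratedFDerivWithin (m := l) (by exact_mod_cast le_top)
                unitCylinder.isOpen.uniqueDiffOn
              exact this.congr fun y hy => (iteratedFDerivWithin_of_isOpen l unitCylinder.isOpen hy).symm
            have h2 : ContinuousOn (radialReflect k) (thinCollar L k) :=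
              (contDiffOn_radialReflect k).continuousOn.mono fun y hy => show 1 / 2 < cylRadius y by
                linarith [hy.1]
            refine h1.comp h2 fun y hy => ?_
            exact cylRadius_radialReflect_lt_one hy.1 (by linarith [hy.2.1])
          exact (hcont.aestronglyMeasurable (isOpen_thinCollar L k).measurableSet).enorm.pow_const _
        rw [hSfun, lintegral_finsetSum' _ hmeas, cellEnergy, mul_sum]
        exact sum_le_sum fun l _ => setLIntegral_comp_radialReflect_le L k _
    _ = ENNReal.ofReal ((K * |Seeley.coeff k| * ((2 : ℝ) ^ k) ^ (2 * n)) ^ 2 * (2 * (n + 1))) * cellEnergy L n f := by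
        rw [← mul_assoc, ← hA, show (2 : ℝ≥0∞) = ENNReal.ofReal 2 by simp, ← ENNReal.ofReal_mul (by positivity)]
        congr 1
        congr 1
        ring


/-! ### The raw extension on the outer collar: Minkowski over `k` and monotone convergence -/

/-- Seeley's summed coefficient constant `𝒮_n = ∑_k |a_k| 4^{kn}` (finite by Seeley's Lemma).
[cite: Seeley1964, Lemma] -/
def seeleySum (n : ℕ) : ℝ := ∑' k, |Seeley.coeff k| * (2 : ℝ) ^ (k * (2 * n))

/-- The partial sums are bounded by `𝒮_n`. [cite: Seeley1964, Lemma] -/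
theorem sum_coeff_le_seeleySum (n N : ℕ) :
    ∑ k ∈ range N, |Seeley.coeff k| * ((2 : ℝ) ^ k) ^ (2 * n) ≤ seeleySum n := by
  have hs := Seeley.summable_abs_coeff_mul_pow (2 * n)
  have heq : ∀ k, |Seeley.coeff k| * ((2 : ℝ) ^ k) ^ (2 * n) = |Seeley.coeff k| * (2 : ℝ) ^ (k * (2 * n)) := fun k => by
    rw [← pow_mul]
  simp only [heq]
  exact hs.sum_le_tsum (range N) fun k _ => by positivity

/-- `𝒮_n ≥ 0`. [folklore] -/
theorem seeleySum_nonneg (n : ℕ) : 0 ≤ seeleySum n :=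
  tsum_nonneg fun k => by positivity

/-- The thresholds `η_N = 1/(4 · 2^N)` with `2^N η_N = 1/4`. [folklore] -/
def etaSeq (N : ℕ) : ℝ := 1 / (4 * (2 : ℝ) ^ N)

/-- `η_N > 0`. [folklore] -/
theorem etaSeq_pos (N : ℕ) : 0 < etaSeq N := by unfold etaSeq; positivity

/-- `2^N η_N = 1/4`. [folklore] -/
theorem pow_mul_etaSeq (N : ℕ) : (2 : ℝ) ^ N * etaSeq N = 1 / 4 := by
  unfold etaSeq
  have : (0 : ℝ) < (2 : ℝ) ^ N := by positivity
  field_simp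

/-- `η` is antitone: `η_{N} ≥ η_{M}` for `N ≤ M`. [folklore] -/
theorem etaSeq_antitone {N M : ℕ} (h : N ≤ M) : etaSeq M ≤ etaSeq N := by
  unfold etaSeq
  have hN : (0 : ℝ) < 4 * (2 : ℝ) ^ N := by positivity
  exact one_div_le_one_div_of_le hN (by gcongr; norm_num)

/-- For every `r > 1` eventually `1 + η_N < r`. [folklore] -/
theorem exists_etaSeq_lt {r : ℝ} (hr : 1 < r) : ∃ N, 1 + etaSeq N < r := by
  obtain ⟨N, hN⟩ := pow_unbounded_of_one_lt (1 / (4 * (r - 1))) (by norm_num : (1 : ℝ) < 2)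
  refine ⟨N, ?_⟩
  unfold etaSeq
  have h4 : (0 : ℝ) < 4 * (r - 1) := by linarith
  rw [div_lt_iff₀ h4] at hN
  have h2 : (0 : ℝ) < 4 * (2 : ℝ) ^ N := by positivity
  rw [← sub_pos]
  have : 1 / (4 * (2 : ℝ) ^ N) < r - 1 := by
    rw [div_lt_iff₀ h2]; linarith
  linarith

/-- On the open set `{r > 1 + η_N}` the raw extension is the finite sum of the first `N` terms.
[cite: Seeley1964, Theorem] -/
theorem rawExtend_eventuallyEq_sum (f : ℝ³ → F) (N : ℕ) {x : ℝ³} (hx : 1 + etaSeq N < cylRadius x) :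
    rawExtend f =ᶠ[𝓝 x] ∑ k ∈ range N, seeleyTerm k f := by
  have ho : IsOpen {y : ℝ³ | 1 + etaSeq N < cylRadius y} := isOpen_lt continuous_const continuous_cylRadius
  filter_upwards [ho.mem_nhds hx] with y hy
  rw [Finset.sum_apply, rawExtend_eq_sum (etaSeq_pos N) (le_of_eq (pow_mul_etaSeq N).symm) hy.le]
  rfl

/-- On `{r > 1 + η_N}` the derivatives of the raw extension are the sums of the derivatives of the
first `N` terms. [folklore] -/
theorem iteratedFDeriv_rawExtend_eq_sum {f : ℝ³ → F} (hf : ContDiffOn ℝ ∞ f 𝕂) (N m : ℕ) {x : ℝ³}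
    (hx : 1 + etaSeq N < cylRadius x) :
    iteratedFDeriv ℝ m (rawExtend f) x = ∑ k ∈ range N, iteratedFDeriv ℝ m (seeleyTerm k f) x := by
  have hx1 : x ∈ exterior := show 1 < cylRadius x by linarith [etaSeq_pos N]
  rw [((rawExtend_eventuallyEq_sum f N hx).iteratedFDeriv ℝ m).eq_of_nhds,
    ← iteratedFDerivWithin_of_isOpen m isOpen_exterior hx1,
    iteratedFDerivWithin_sum_apply isOpen_exterior.uniqueDiffOn hx1 fun k _ =>
      ((contDiffOn_seeleyTerm_exterior k hf x hx1).of_le (by exact_mod_cast le_top))]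
  exact sum_congr rfl fun k _ => iteratedFDerivWithin_of_isOpen m isOpen_exterior hx1

/-- **`L²` bound for the raw extension on the outer collar**:
`∫⁻_{outer} ‖Dᵐ (rawExtend f)‖ₑ² ≤ C 𝓔_n(f)` for `m ≤ n`, with `C = 2(n+1)(K 𝒮_n)²`.
[cite: Seeley1964, Theorem] -/
theorem lintegral_rawExtend_sq_le [CompleteSpace F] (n : ℕ) : ∃ C : ℝ, 0 ≤ C ∧ ∀ (L : ℝ) (f : ℝ³ → F),
    ContDiffOn ℝ ∞ f 𝕂 → ∀ m ≤ n,
      ∫⁻ x in outer L, ‖iteratedFDeriv ℝ m (rawExtend f) x‖ₑ ^ 2 ≤ ENNReal.ofReal C * cellEnergy L n f := by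
  obtain ⟨K, hK0, hK⟩ := lintegral_seeleyTerm_sq_le (F := F) n
  have hS0 : 0 ≤ seeleySum n := seeleySum_nonneg n
  refine ⟨(K * seeleySum n) ^ 2 * (2 * (n + 1)), by positivity, fun L f hf m hmn => ?_⟩
  have hraw : ContDiff ℝ ∞ (rawExtend f) := contDiff_rawExtend hf
  set h : ℝ³ → ℝ≥0∞ := fun x => ‖iteratedFDeriv ℝ m (rawExtend f) x‖ₑ ^ 2 with hh
  have hhm : Measurable h := by
    have hc : Continuous fun x => iteratedFDeriv ℝ m (rawExtend f) x :=
      hraw.continuous_iteratedFDeriv (by exact_mod_cast le_top)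
    exact hc.enorm.measurable.pow_const _
  set U : ℕ → Set ℝ³ := fun N => {x | 1 + etaSeq N < cylRadius x} with hU
  have hUo : ∀ N, IsOpen (U N) := fun N => isOpen_lt continuous_const continuous_cylRadius
  have hUmono : Monotone U := fun N M hNM x hx =>
    show 1 + etaSeq M < cylRadius x from lt_of_le_of_lt (by linarith [etaSeq_antitone hNM]) hx
  -- the target bound
  set R : ℝ≥0∞ := (ENNReal.ofReal (2 * (n + 1)) * cellEnergy L n f) ^ (1 / 2 : ℝ) with hR
  have hR2 : R ^ 2 = ENNReal.ofReal (2 * (n + 1)) * cellEnergy L n f := by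
    rw [hR, ← ENNReal.rpow_ofNat, ← ENNReal.rpow_mul]
    norm_num
  set B : ℝ≥0∞ := ENNReal.ofReal (K * seeleySum n) * R with hB
  have hB2 : B ^ 2 = ENNReal.ofReal ((K * seeleySum n) ^ 2 * (2 * (n + 1))) * cellEnergy L n f := by
    rw [hB, mul_pow, hR2, ← mul_assoc, ← ENNReal.ofReal_pow (by positivity), ← ENNReal.ofReal_mul (by positivity)]
  -- Step 1: the bound on each `outer ∩ U N`
  have hstep : ∀ N, ∫⁻ x in outer L ∩ U N, h x ≤ B ^ 2 := by
    intro N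
    have hOUm : MeasurableSet (outer L ∩ U N) := (isOpen_outer L).measurableSet.inter (hUo N).measurableSet
    set μ := volume.restrict (outer L ∩ U N) with hμ
    -- the derivative is the finite sum a.e. (everywhere) on the set
    have hae : (fun x => iteratedFDeriv ℝ m (rawExtend f) x) =ᵐ[μ]
        ∑ k ∈ range N, fun x => iteratedFDeriv ℝ m (seeleyTerm k f) x := by
      refine ae_restrict_of_forall_mem hOUm fun x hx => ?_
      rw [Finset.sum_apply]
      exact iteratedFDeriv_rawExtend_eq_sum hf N m hx.2
    have hmeas : ∀ k ∈ range N, AEStronglyMeasurable (fun x => iteratedFDeriv ℝ m (seeleyTerm k f) x) μ := by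
      intro k _
      have hc : ContinuousOn (iteratedFDeriv ℝ m (seeleyTerm k f)) exterior := by
        have := (contDiffOn_seeleyTerm_exterior k hf).continuousOn_iteratedFDerivWithin (m := m)
          (by exact_mod_cast le_top) isOpen_exterior.uniqueDiffOn
        exact this.congr fun y hy => (iteratedFDerivWithin_of_isOpen m isOpen_exterior hy).symm
      have h1 : AEStronglyMeasurable (fun x => iteratedFDeriv ℝ m (seeleyTerm k f) x)
          (volume.restrict exterior) := hc.aestronglyMeasurable isOpen_exterior.measurableSet
      exact h1.mono_measure (Measure.restrict_mono (fun x hx => hx.1.1) le_rfl)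
    -- Minkowski
    have hMink : eLpNorm (fun x => iteratedFDeriv ℝ m (rawExtend f) x) 2 μ ≤ B := by
      rw [eLpNorm_congr_ae hae]
      refine (eLpNorm_sum_le hmeas (by norm_num)).trans ?_
      -- each term
      have hterm : ∀ k ∈ range N, eLpNorm (fun x => iteratedFDeriv ℝ m (seeleyTerm k f) x) 2 μ ≤
          ENNReal.ofReal (K * |Seeley.coeff k| * ((2 : ℝ) ^ k) ^ (2 * n)) * R := by
        intro k _
        refine eLpNorm_two_le_of_lintegral_le ?_
        rw [mul_pow, hR2, ← mul_assoc, ← ENNReal.ofReal_pow (by positivity), ← ENNReal.ofReal_mul (by positivity)]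
        calc ∫⁻ x, ‖iteratedFDeriv ℝ m (seeleyTerm k f) x‖ₑ ^ 2 ∂μ
            ≤ ∫⁻ x in outer L, ‖iteratedFDeriv ℝ m (seeleyTerm k f) x‖ₑ ^ 2 :=
              lintegral_mono_set inter_subset_left
          _ ≤ _ := hK L k f hf m hmn
      calc ∑ k ∈ range N, eLpNorm (fun x => iteratedFDeriv ℝ m (seeleyTerm k f) x) 2 μ
          ≤ ∑ k ∈ range N, ENNReal.ofReal (K * |Seeley.coeff k| * ((2 : ℝ) ^ k) ^ (2 * n)) * R := sum_le_sum hterm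
        _ = ENNReal.ofReal (∑ k ∈ range N, K * |Seeley.coeff k| * ((2 : ℝ) ^ k) ^ (2 * n)) * R := by
            rw [← sum_mul, ENNReal.ofReal_sum_of_nonneg fun k _ => by positivity]
        _ ≤ B := by
            refine mul_le_mul' (ENNReal.ofReal_le_ofReal ?_) le_rfl
            have := sum_coeff_le_seeleySum n N
            calc ∑ k ∈ range N, K * |Seeley.coeff k| * ((2 : ℝ) ^ k) ^ (2 * n)
                = K * ∑ k ∈ range N, |Seeley.coeff k| * ((2 : ℝ) ^ k) ^ (2 * n) := by
                  rw [mul_sum]; exact sum_congr rfl fun k _ => by ring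
              _ ≤ K * seeleySum n := mul_le_mul_of_nonneg_left this hK0
    exact lintegral_le_of_eLpNorm_two_le hMink
  -- Step 2: monotone convergence over `N`
  have hsup : ∫⁻ x in outer L, h x = ⨆ N, ∫⁻ x in outer L, (U N).indicator h x := by
    rw [← lintegral_iSup (fun N => hhm.indicator (hUo N).measurableSet)
      (fun N M hNM => indicator_le_indicator_of_subset (hUmono hNM) fun _ => bot_le)]
    refine setLIntegral_congr_fun (isOpen_outer L).measurableSet fun x hx => ?_
    obtain ⟨N₀, hN₀⟩ := exists_etaSeq_lt hx.1
    apply le_antisymm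
    · exact le_iSup_of_le N₀ (by rw [indicator_of_mem (show x ∈ U N₀ from hN₀)])
    · exact iSup_le fun N => indicator_le_self _ _ _
  rw [hh] at hsup
  rw [hsup]
  refine iSup_le fun N => ?_
  rw [lintegral_indicator (hUo N).measurableSet, Measure.restrict_restrict (hUo N).measurableSet, Set.inter_comm]
  rw [hB2] at hstep
  exact hstep N


/-! ### The cutoff -/

/-- The axial shift vector `L e₂`. -/
local notation "𝐯" L':max => (L' : ℝ) • EuclideanSpace.single (2 : Fin 3) (1 : ℝ)

/-- The radial cutoff of `cylExtend`. [folklore] -/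
abbrev extCutoff : ℝ³ → ℝ := cylRadialCutoff (9 / 8) (5 / 4)

/-- The cutoff is axially invariant. [folklore] -/
theorem extCutoff_add_axialShift (x : ℝ³) (s : ℝ) : extCutoff (x + 𝐯 s) = extCutoff x := by
  simp [extCutoff, cylRadialCutoff]

/-- The compact slice `{r ≤ 3/2, z = 0}`. [folklore] -/
def innerSlice : Set ℝ³ := {x | cylRadius x ≤ 3 / 2 ∧ x 2 = 0}

/-- The inner slice is compact. [folklore] -/
theorem isCompact_innerSlice : IsCompact innerSlice := by
  refine Metric.isCompact_of_isClosed_isBounded ?_ ?_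
  · exact (isClosed_le continuous_cylRadius continuous_const).inter
      (isClosed_eq ((EuclideanSpace.proj (2 : Fin 3)).continuous) continuous_const)
  · refine (Metric.isBounded_closedBall (x := (0 : ℝ³)) (r := 3 / 2)).subset fun x hx => ?_
    obtain ⟨h2, h3⟩ := hx
    rw [Metric.mem_closedBall, dist_zero_right, EuclideanSpace.norm_eq, Fin.sum_univ_three, h3]
    have hr : x 0 ^ 2 + x 1 ^ 2 = cylRadius x ^ 2 := (cylRadius_sq x).symm
    simp only [Real.norm_eq_abs, sq_abs]
    rw [show x 0 ^ 2 + x 1 ^ 2 + (0 : ℝ) ^ 2 = cylRadius x ^ 2 by rw [← hr]; ring,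
      Real.sqrt_sq (cylRadius_nonneg x)]
    exact h2

/-- **Uniform bounds for the derivatives of the cutoff** on `{r ≤ 3/2}` up to order `n`. [folklore] -/
theorem exists_bound_extCutoff (n : ℕ) : ∃ C : ℝ, 0 ≤ C ∧ ∀ i ≤ n, ∀ x : ℝ³, cylRadius x ≤ 3 / 2 →
    ‖iteratedFDeriv ℝ i extCutoff x‖ ≤ C := by
  obtain ⟨C, hC0, hC⟩ := exists_bound_iteratedFDeriv_of_isCompact isOpen_univ isCompact_innerSlice
    (subset_univ _) (contDiff_cylRadialCutoff (9 / 8) (5 / 4)).contDiffOn n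
  refine ⟨C, hC0, fun i hi x hx => ?_⟩
  have hy : x + 𝐯 (-(x 2)) ∈ innerSlice := ⟨by rw [cylRadius_add_axialShift]; exact hx, by simp⟩
  have hxy : x = (x + 𝐯 (-(x 2))) + 𝐯 (x 2) := by
    rw [add_assoc, ← add_smul, neg_add_cancel, zero_smul, add_zero]
  rw [hxy, iteratedFDeriv_add_axialShift_of_invariant (fun z => extCutoff_add_axialShift z (x 2))]
  exact hC i hi _ hy

/-! ### The extension on the outer collar -/

/-- **`L²` bound for the extension on the outer collar** (Leibniz rule with the cutoff):
`∫⁻_{outer} ‖Dʲ (cylExtend f)‖ₑ² ≤ C 𝓔_n(f)` for `j ≤ n`. [cite: Seeley1964, Theorem] -/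
theorem lintegral_cylExtend_sq_outer_le [CompleteSpace F] (n : ℕ) : ∃ C : ℝ, 0 ≤ C ∧ ∀ (L : ℝ) (f : ℝ³ → F),
    ContDiffOn ℝ ∞ f 𝕂 → ∀ j ≤ n,
      ∫⁻ x in outer L, ‖iteratedFDeriv ℝ j (cylExtend f) x‖ₑ ^ 2 ≤ ENNReal.ofReal C * cellEnergy L n f := by
  obtain ⟨CB, hCB0, hCB⟩ := lintegral_rawExtend_sq_le (F := F) n
  obtain ⟨Cχ, hCχ0, hCχ⟩ := exists_bound_extCutoff n
  refine ⟨(2 ^ n * Cχ) ^ 2 * (n + 1) * ((n + 1) * CB), by positivity, fun L f hf j hjn => ?_⟩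
  have hraw : ContDiff ℝ ∞ (rawExtend f) := contDiff_rawExtend hf
  have hχ : ContDiff ℝ ∞ extCutoff := contDiff_cylRadialCutoff _ _
  have hdef : cylExtend f = fun y => extCutoff y • rawExtend f y := rfl
  set Sraw : ℝ³ → ℝ := fun x => ∑ m ∈ range (n + 1), ‖iteratedFDeriv ℝ m (rawExtend f) x‖ with hSraw
  -- pointwise Leibniz bound on the outer collar
  have hpt : ∀ x ∈ outer L, ‖iteratedFDeriv ℝ j (cylExtend f) x‖ ^ 2 ≤
      (2 ^ n * Cχ) ^ 2 * (n + 1) * ∑ m ∈ range (n + 1), ‖iteratedFDeriv ℝ m (rawExtend f) x‖ ^ 2 := by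
    intro x hx
    have hxr : cylRadius x ≤ 3 / 2 := by linarith [hx.2.1]
    have hL := norm_iteratedFDeriv_smul_le (𝕜 := ℝ) hχ hraw x (n := j) (by exact_mod_cast le_top)
    rw [hdef]
    have h1 : ‖iteratedFDeriv ℝ j (fun y => extCutoff y • rawExtend f y) x‖ ≤ 2 ^ n * Cχ * Sraw x := by
      refine hL.trans ?_
      calc ∑ i ∈ range (j + 1), (j.choose i : ℝ) * ‖iteratedFDeriv ℝ i extCutoff x‖ *
              ‖iteratedFDeriv ℝ (j - i) (rawExtend f) x‖
          ≤ ∑ i ∈ range (j + 1), (j.choose i : ℝ) * (Cχ * Sraw x) := by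
            refine sum_le_sum fun i hi => ?_
            have hij : i ≤ j := Nat.lt_succ_iff.1 (mem_range.1 hi)
            rw [mul_assoc]
            refine mul_le_mul_of_nonneg_left (mul_le_mul (hCχ i (hij.trans hjn) x hxr) ?_ (norm_nonneg _) hCχ0)
              (by positivity)
            exact single_le_sum (f := fun m => ‖iteratedFDeriv ℝ m (rawExtend f) x‖) (fun m _ => norm_nonneg _)
              (mem_range.2 (by omega))
        _ = 2 ^ j * (Cχ * Sraw x) := by
            rw [← sum_mul]
            congr 1
            exact_mod_cast Nat.sum_range_choose j
        _ ≤ 2 ^ n * (Cχ * Sraw x) := by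
            have : (0 : ℝ) ≤ Cχ * Sraw x := mul_nonneg hCχ0 (sum_nonneg fun m _ => norm_nonneg _)
            exact mul_le_mul_of_nonneg_right (pow_le_pow_right₀ (by norm_num) hjn) this
        _ = 2 ^ n * Cχ * Sraw x := by ring
    have h2 := sq_sum_le_card_mul_sum_sq (s := range (n + 1)) (f := fun m => ‖iteratedFDeriv ℝ m (rawExtend f) x‖)
    rw [card_range] at h2
    calc ‖iteratedFDeriv ℝ j (fun y => extCutoff y • rawExtend f y) x‖ ^ 2 ≤ (2 ^ n * Cχ * Sraw x) ^ 2 :=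
          pow_le_pow_left₀ (norm_nonneg _) h1 2
      _ = (2 ^ n * Cχ) ^ 2 * (Sraw x) ^ 2 := by ring
      _ ≤ (2 ^ n * Cχ) ^ 2 * ((n + 1 : ℕ) * ∑ m ∈ range (n + 1), ‖iteratedFDeriv ℝ m (rawExtend f) x‖ ^ 2) :=
          mul_le_mul_of_nonneg_left h2 (sq_nonneg _)
      _ = _ := by push_cast; ring
  -- integrate
  have hmeas : ∀ m ∈ range (n + 1), Measurable fun x => ‖iteratedFDeriv ℝ m (rawExtend f) x‖ₑ ^ 2 := by
    intro m _
    have hc : Continuous fun x => iteratedFDeriv ℝ m (rawExtend f) x :=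
      hraw.continuous_iteratedFDeriv (by exact_mod_cast le_top)
    exact hc.enorm.measurable.pow_const _
  calc ∫⁻ x in outer L, ‖iteratedFDeriv ℝ j (cylExtend f) x‖ₑ ^ 2
      ≤ ∫⁻ x in outer L, ENNReal.ofReal ((2 ^ n * Cχ) ^ 2 * (n + 1)) *
          ∑ m ∈ range (n + 1), ‖iteratedFDeriv ℝ m (rawExtend f) x‖ₑ ^ 2 := by
        refine setLIntegral_mono' (isOpen_outer L).measurableSet fun x hx => ?_
        rw [← ofReal_norm_sq]
        refine (ENNReal.ofReal_le_ofReal (hpt x hx)).trans (le_of_eq ?_)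
        rw [ENNReal.ofReal_mul (by positivity), ENNReal.ofReal_sum_of_nonneg fun m _ => sq_nonneg _]
        simp only [ofReal_norm_sq]
    _ = ENNReal.ofReal ((2 ^ n * Cχ) ^ 2 * (n + 1)) *
          ∑ m ∈ range (n + 1), ∫⁻ x in outer L, ‖iteratedFDeriv ℝ m (rawExtend f) x‖ₑ ^ 2 := by
        rw [lintegral_const_mul' _ _ ENNReal.ofReal_ne_top, lintegral_finsetSum _ hmeas]
    _ ≤ ENNReal.ofReal ((2 ^ n * Cχ) ^ 2 * (n + 1)) *
          ∑ m ∈ range (n + 1), ENNReal.ofReal CB * cellEnergy L n f := by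
        gcongr with m hm
        exact hCB L f hf m (Nat.lt_succ_iff.1 (mem_range.1 hm))
    _ = ENNReal.ofReal ((2 ^ n * Cχ) ^ 2 * (n + 1) * ((n + 1) * CB)) * cellEnergy L n f := by
        rw [sum_const, card_range, nsmul_eq_mul, ← mul_assoc, ← mul_assoc]
        congr 1
        have hn1 : ((n + 1 : ℕ) : ℝ≥0∞) = ENNReal.ofReal ((n : ℝ) + 1) := by
          rw [show ((n : ℝ) + 1) = ((n + 1 : ℕ) : ℝ) by push_cast; ring, ENNReal.ofReal_natCast]
        rw [hn1, ← ENNReal.ofReal_mul (by positivity), ← ENNReal.ofReal_mul (by positivity)]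
        congr 1
        ring

/-! ### The slab bound -/

/-- Inside the open cylinder the derivatives of the extension are those of `f`. [folklore] -/
theorem iteratedFDeriv_cylExtend_of_lt_one (f : ℝ³ → F) {x : ℝ³} (hx : cylRadius x < 1) (j : ℕ) :
    iteratedFDeriv ℝ j (cylExtend f) x = iteratedFDeriv ℝ j f x := by
  have hev : cylExtend f =ᶠ[𝓝 x] f := by
    filter_upwards [unitCylinder.isOpen.mem_nhds (show x ∈ (unitCylinder : Set ℝ³) from hx)] with y hy
    exact cylExtend_of_le_one (le_of_lt hy)
  exact (hev.iteratedFDeriv ℝ j).eq_of_nhds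

/-- Beyond `{r = 5/4}` the derivatives of the extension vanish. [folklore] -/
theorem iteratedFDeriv_cylExtend_of_gt (f : ℝ³ → F) {x : ℝ³} (hx : 5 / 4 < cylRadius x) (j : ℕ) :
    iteratedFDeriv ℝ j (cylExtend f) x = 0 := by
  have ho : IsOpen {y : ℝ³ | 5 / 4 < cylRadius y} := isOpen_lt continuous_const continuous_cylRadius
  have hev : cylExtend f =ᶠ[𝓝 x] fun _ => (0 : F) := by
    filter_upwards [ho.mem_nhds hx] with y hy
    exact cylExtend_eq_zero hy.le
  rw [(hev.iteratedFDeriv ℝ j).eq_of_nhds]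
  rcases j with _ | j
  · ext; simp
  · rw [iteratedFDeriv_succ_const, Pi.zero_apply]

/-- **Sobolev bounds of the radial Seeley extension, all orders from one operator** (Seeley 1964;
Kato–Lai 1984, §7, (7.1)): for every `n` there is `C` such that for every period `L`, every `f`
which is `C^∞` on the closed cylinder and every `j ≤ n`,
`∫⁻_{0 < z < L} ‖Dʲ (cylExtend f)‖ₑ² ≤ C ∑_{l ≤ n} ∫⁻_{cell L} ‖Dˡ f‖ₑ²`. [cite: Seeley1964, Theorem] -/
theorem exists_lintegral_iteratedFDeriv_cylExtend_le [CompleteSpace F] (n : ℕ) : ∃ C : ℝ, 0 ≤ C ∧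
    ∀ (L : ℝ) (f : ℝ³ → F), ContDiffOn ℝ ∞ f 𝕂 → ∀ j ≤ n,
      ∫⁻ x in {x : ℝ³ | x 2 ∈ Set.Ioo 0 L}, ‖iteratedFDeriv ℝ j (cylExtend f) x‖ₑ ^ 2 ≤
        ENNReal.ofReal C * cellEnergy L n f := by
  obtain ⟨C, hC0, hC⟩ := lintegral_cylExtend_sq_outer_le (F := F) n
  refine ⟨1 + C, by positivity, fun L f hf j hjn => ?_⟩
  set G : ℝ³ → ℝ≥0∞ := fun x => ‖iteratedFDeriv ℝ j (cylExtend f) x‖ₑ ^ 2 with hG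
  -- decomposition of the slab
  have hsub : {x : ℝ³ | x 2 ∈ Set.Ioo 0 L} ⊆
      (((cylinderCell L : Set ℝ³) ∪ {x | cylRadius x = 1}) ∪ outer L) ∪
        ({x | cylRadius x = 5 / 4} ∪ {x | 5 / 4 < cylRadius x}) := by
    intro x hx
    rcases lt_trichotomy (cylRadius x) 1 with h | h | h
    · exact Or.inl (Or.inl (Or.inl ⟨h, hx⟩))
    · exact Or.inl (Or.inl (Or.inr h))
    · rcases lt_trichotomy (cylRadius x) (5 / 4) with h' | h' | h'
      · exact Or.inl (Or.inr ⟨h, h', hx⟩)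
      · exact Or.inr (Or.inl h')
      · exact Or.inr (Or.inr h')
  -- the pieces
  have hcell : ∫⁻ x in (cylinderCell L : Set ℝ³), G x ≤ cellEnergy L n f := by
    calc ∫⁻ x in (cylinderCell L : Set ℝ³), G x = ∫⁻ x in (cylinderCell L : Set ℝ³), ‖iteratedFDeriv ℝ j f x‖ₑ ^ 2 :=
          setLIntegral_congr_fun (cylinderCell L).isOpen.measurableSet fun x hx => by
            simp only [hG, iteratedFDeriv_cylExtend_of_lt_one f hx.1 j]
      _ ≤ cellEnergy L n f :=
          single_le_sum (f := fun l => ∫⁻ x in (cylinderCell L : Set ℝ³), ‖iteratedFDeriv ℝ l f x‖ₑ ^ 2)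
            (fun l _ => bot_le) (mem_range.2 (Nat.lt_succ_of_le hjn))
  have hwall : ∫⁻ x in {x : ℝ³ | cylRadius x = 1}, G x = 0 := setLIntegral_cylRadius_eq 1 G
  have hlevel : ∫⁻ x in {x : ℝ³ | cylRadius x = 5 / 4}, G x = 0 := setLIntegral_cylRadius_eq _ G
  have hfar : ∫⁻ x in {x : ℝ³ | 5 / 4 < cylRadius x}, G x = 0 := by
    have ho : IsOpen {y : ℝ³ | 5 / 4 < cylRadius y} := isOpen_lt continuous_const continuous_cylRadius
    rw [setLIntegral_congr_fun ho.measurableSet (g := fun _ => 0) fun x hx => by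
      simp only [hG, iteratedFDeriv_cylExtend_of_gt f hx j, enorm_zero, ne_eq, OfNat.ofNat_ne_zero,
        not_false_eq_true, zero_pow]]
    exact lintegral_zero
  calc ∫⁻ x in {x : ℝ³ | x 2 ∈ Set.Ioo 0 L}, G x
      ≤ ∫⁻ x in (((cylinderCell L : Set ℝ³) ∪ {x | cylRadius x = 1}) ∪ outer L) ∪
          ({x | cylRadius x = 5 / 4} ∪ {x | 5 / 4 < cylRadius x}), G x := lintegral_mono_set hsub
    _ ≤ ((∫⁻ x in (cylinderCell L : Set ℝ³), G x) + (∫⁻ x in {x : ℝ³ | cylRadius x = 1}, G x) +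
          ∫⁻ x in outer L, G x) +
          ((∫⁻ x in {x : ℝ³ | cylRadius x = 5 / 4}, G x) + ∫⁻ x in {x : ℝ³ | 5 / 4 < cylRadius x}, G x) := by
        refine (lintegral_union_le _ _ _).trans (add_le_add ?_ (lintegral_union_le _ _ _))
        exact (lintegral_union_le _ _ _).trans (add_le_add (lintegral_union_le _ _ _) le_rfl)
    _ ≤ cellEnergy L n f + 0 + ENNReal.ofReal C * cellEnergy L n f + (0 + 0) := by
        gcongr
        · exact hwall.le
        · exact hC L f hf j hjn
        · exact hlevel.le
        · exact hfar.le
    _ = ENNReal.ofReal (1 + C) * cellEnergy L n f := by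
        rw [ENNReal.ofReal_add zero_le_one hC0, ENNReal.ofReal_one, add_mul, one_mul]
        simp

end PeriodicCylinder

end Literature.Analysis.FluidPDE
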